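import Mathlib.GroupTheory.SpecificGroups.Cyclic
import Mathlib.GroupTheory.Perm.Cycle.Type
import Mathlib.GroupTheory.IndexNormal
import Mathlib.Algebra.Group.Conj
import Mathlib.SetTheory.Cardinal.Finite
import Summits.MatrixMultiplication.OmegaCensus.CentreIndexSixTPP

/-!
# ω-census, family (b3): groups with centre of index `6` carry coordinates — the literal law `[G : Z(G)] = 6 ⇒ 3|S||T||U| ≤ 5|G|`

HONEST FRAMING (pub-omega census; verbatim): lottery ticket; floor = certified bounds/negative ranges.
Census BOOKKEEPING (prereg P-028, items .3/.4): discharges the package `Coord c κ ε` of `CentreIndexSixCoord.lean` from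
`(Subgroup.center G).index = 6`, so the law of `CentreIndexSixTPP.lean` reads literally "`[G : Z(G)] = 6` ⇒ every TPP triple with
`|T|, |U| ≤ 3` has `3|S||T||U| ≤ 5|G|` (`= 3 Σ_χ χ(1)³`) ⇒ no `⟨N, 3, 3⟩` in any order when `5|G| < 27N`" (`three_mul_volume_le_of_index_center`,
`not_realizesTPP_three_three_of_index_center`).  A certified NEGATIVE RANGE for single TPP triples; nothing here is progress on `ω`.
PROOF (`exists_coord`).  `Q = G/Z(G)` has order `6` and is not cyclic, so (Cauchy) it has `ā` of order `3`, `b̄` of order `2`; `⟨ā⟩` has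
index `2`, is normal, and `b̄ ā b̄⁻¹ = ā⁻¹` (not `1`; `ā` would make `ā b̄` of order `6`).  Lift to `x, y ∈ G`, `k = [x, y]` (class `ā²`): from
`y² ∈ Z(G)` alone `y k y⁻¹ = k⁻¹`; as `k³` is central, `k³ = y k³ y⁻¹ = k⁻³`, so `k⁶ = 1` and `c := k⁴` has `c³ = 1`, `y c y⁻¹ = c⁻¹`, class `ā²`
(this explicit computation replaces the triviality of the Schur multiplier of `S₃`).  The six classes `c̄^i b̄^j` exhaust `Q` (an injection
`Fin 3 × Fin 2 → Q` of sets of size `6`), defining `κ(g) = i`, `ε(g) = (−1)^j`; the cocycle law and multiplicativity of `ε` are the product of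
normal forms (`b̄ c̄^n = c̄^{2n} b̄`).  Every `g = c^n γ` with `γ ∈ C = Z(G) ∪ y Z(G)`; `C` is commutative, closed under `·`, `⁻¹`, and conjugates `c`
to `c^{±1}`, so `[c^i γ, c^{i'} δ] ∈ {1, c, c²}` exactly in `G` — the commutator axiom.  Elementary census bookkeeping (pub-omega stpp-1 gen 13);
not a published statement (the structure fact "`G/Z ≅ S₃ ⇒ G ≅ C₃ ⋊ C`" is folklore).
-/

open Finset
open Literature.Combinatorics.Additive

namespace Summit.MatrixMultiplication.OmegaCensus.CentreIndexSix

variable {G : Type*} [Group G]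

/-! ### `G`-level identities for the lifted generators

`x, y` lift a dihedral pair of `G/Z(G)`, `k = [x, y]`; only `y² ∈ Z(G)` and `k³ ∈ Z(G)` are used: `y` inverts `k`, so `k³ = y k³ y⁻¹ = k⁻³`,
`k⁶ = 1`, and `c := k⁴` has `c³ = 1`, `y c y⁻¹ = c⁻¹` (same class as `k` in `G/Z(G)`). -/

section Lift

variable {x y k : G}

/-- `y` inverts `k = [x, y]` (uses only `y² ∈ Z(G)`). [folklore] -/
theorem y_conj_comm (hk : k = x * y * x⁻¹ * y⁻¹) (hyy : y * y ∈ Subgroup.center G) : y * k * y⁻¹ = k⁻¹ := by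
  have hs : ∀ g : G, g * (y * y)⁻¹ = (y * y)⁻¹ * g := fun g =>
    Subgroup.mem_center_iff.1 (Subgroup.inv_mem _ hyy) g
  subst hk
  calc y * (x * y * x⁻¹ * y⁻¹) * y⁻¹ = y * x * y * (x⁻¹ * (y * y)⁻¹) := by group
    _ = y * x * y * ((y * y)⁻¹ * x⁻¹) := by rw [hs]
    _ = (x * y * x⁻¹ * y⁻¹)⁻¹ := by group

/-- If `y` inverts `k` and `k³` is central then `k⁶ = 1`. [folklore] -/
theorem pow_six_eq_one (e : y * k * y⁻¹ = k⁻¹) (hk3 : k * k * k ∈ Subgroup.center G) : k * k * k * (k * k * k) = 1 := by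
  have ht : y * (k * k * k) = k * k * k * y := Subgroup.mem_center_iff.1 hk3 y
  have e3 : k * k * k = k⁻¹ * k⁻¹ * k⁻¹ := by
    calc k * k * k = k * k * k * y * y⁻¹ := by group
      _ = y * (k * k * k) * y⁻¹ := by rw [← ht]
      _ = y * k * y⁻¹ * (y * k * y⁻¹) * (y * k * y⁻¹) := by group
      _ = k⁻¹ * k⁻¹ * k⁻¹ := by rw [e]
  calc k * k * k * (k * k * k) = k * k * k * (k⁻¹ * k⁻¹ * k⁻¹) := by rw [← e3]
    _ = 1 := by group

/-- `c = k⁴` has `c³ = 1`. [folklore] -/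
theorem c_cube (e : y * k * y⁻¹ = k⁻¹) (hk3 : k * k * k ∈ Subgroup.center G) :
    k * k * k * k * (k * k * k * k) * (k * k * k * k) = 1 := by
  have h6 := pow_six_eq_one e hk3
  calc k * k * k * k * (k * k * k * k) * (k * k * k * k) = k * k * k * (k * k * k) * (k * k * k * (k * k * k)) := by group
    _ = 1 := by rw [h6, one_mul]

/-- `y` inverts `c = k⁴`. [folklore] -/
theorem y_conj_c (e : y * k * y⁻¹ = k⁻¹) : y * (k * k * k * k) * y⁻¹ = (k * k * k * k)⁻¹ := by
  calc y * (k * k * k * k) * y⁻¹ = y * k * y⁻¹ * (y * k * y⁻¹) * (y * k * y⁻¹) * (y * k * y⁻¹) := by group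
    _ = (k * k * k * k)⁻¹ := by rw [e]; group

end Lift

/-! ## Groups with centre of index `6` -/

section IndexSix

variable (h6 : (Subgroup.center G).index = 6)
include h6

/-- `|G / Z(G)| = 6`. [folklore] -/
theorem card_quot_center : Nat.card (G ⧸ Subgroup.center G) = 6 := by rw [← Subgroup.index_eq_card]; exact h6

/-- `G` is not commutative. [folklore] -/
theorem exists_not_comm : ∃ a b : G, a * b ≠ b * a := by
  by_contra! hall
  have htop : Subgroup.center G = ⊤ := by
    rw [Subgroup.eq_top_iff']; intro x; rw [Subgroup.mem_center_iff]; intro g; exact hall g x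
  rw [htop, Subgroup.index_top] at h6
  exact absurd h6 (by norm_num)

/-- `G / Z(G)` is not cyclic. [folklore] -/
theorem not_isCyclic_quot : ¬ IsCyclic (G ⧸ Subgroup.center G) := by
  intro hcyc
  have hcomm := (QuotientGroup.mk' (Subgroup.center G)).isMulCommutative_of_isCyclic_of_ker_le_center
    (by rw [QuotientGroup.ker_mk'])
  obtain ⟨a, b, hab⟩ := exists_not_comm h6
  exact hab (hcomm.is_comm.comm a b)

variable [Finite G]

/-- In `G / Z(G)`: an element of order `3`, an element of order `2`, and the dihedral relation between them. [folklore] -/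
theorem exists_dihedral_pair : ∃ a b : G ⧸ Subgroup.center G, orderOf a = 3 ∧ orderOf b = 2 ∧ b * a * b⁻¹ = a⁻¹ := by
  classical
  have hcard := card_quot_center h6
  obtain ⟨a, ha⟩ := exists_prime_orderOf_dvd_card' (G := G ⧸ Subgroup.center G) 3 (by rw [hcard]; norm_num)
  obtain ⟨b, hb⟩ := exists_prime_orderOf_dvd_card' (G := G ⧸ Subgroup.center G) 2 (by rw [hcard]; norm_num)
  refine ⟨a, b, ha, hb, ?_⟩
  -- `⟨a⟩` has index `2`, hence is normal
  have hN : Nat.card (Subgroup.zpowers a) = 3 := by rw [Nat.card_zpowers, ha]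
  have hidx : (Subgroup.zpowers a).index = 2 := by
    have := (Subgroup.zpowers a).index_mul_card; rw [hN, hcard] at this; omega
  haveI := Subgroup.normal_of_index_eq_two hidx
  have hmem : b * a * b⁻¹ ∈ Subgroup.zpowers a := Subgroup.Normal.conj_mem inferInstance a (Subgroup.mem_zpowers a) b
  rw [(isOfFinOrder_of_finite a).mem_zpowers_iff_mem_range_orderOf, ha, mem_image] at hmem
  obtain ⟨k, hk, hk'⟩ := hmem
  rw [mem_range] at hk
  have ha3 : a ^ 3 = 1 := by rw [← ha]; exact pow_orderOf_eq_one a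
  have ha3' : a * a * a = 1 := by rw [← ha3, pow_succ, pow_two]
  interval_cases k
  · -- `b a b⁻¹ = 1`: then `a = 1`
    exfalso
    have : a = 1 := by
      calc a = b⁻¹ * (b * a * b⁻¹) * b := by group
        _ = 1 := by rw [← hk', pow_zero]; group
    rw [this, orderOf_one] at ha; exact absurd ha (by norm_num)
  · -- `b a b⁻¹ = a`: then `a b` has order `6` and the quotient is cyclic
    exfalso
    rw [pow_one] at hk'
    have e : b * a * b⁻¹ = a := hk'.symm
    have hc : Commute a b := by
      show a * b = b * a
      calc a * b = b * a * b⁻¹ * b := by rw [e]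
        _ = b * a := by group
    have h6' : orderOf (a * b) = 6 := by rw [hc.orderOf_mul_eq_mul_orderOf_of_coprime (by rw [ha, hb]; decide), ha, hb]
    exact not_isCyclic_quot h6 (isCyclic_of_orderOf_eq_card (a * b) (by rw [h6', hcard]))
  · rw [← hk']
    calc a ^ 2 = a ^ 3 * a⁻¹ := by group
      _ = a⁻¹ := by rw [ha3, one_mul]


/-- **Coordinates from the index.** A group whose centre has index `6` carries coordinates `Coord c κ ε`
(`c = [x, y]⁴` for lifts `x, y` of a dihedral pair of `G/Z(G)`; `κ, ε` read off the normal form `c̄^i b̄^j` in `G/Z(G)`;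
the commutator axiom is the `G`-level computation `[c^i γ, c^{i'} δ] ∈ ⟨c⟩` for `γ, δ ∈ Z(G) ∪ y Z(G)`). [folklore] -/
theorem exists_coord : ∃ (c : G) (κ ε : G → ZMod 3), Coord c κ ε := by
  classical
  obtain ⟨a, b, ha, hb, hrel⟩ := exists_dihedral_pair h6
  obtain ⟨x, hx⟩ := QuotientGroup.mk_surjective a
  obtain ⟨y, hy⟩ := QuotientGroup.mk_surjective b
  have hZ : ∀ {z : G}, z ∈ Subgroup.center G → ∀ g : G, g * z = z * g := fun hz g => Subgroup.mem_center_iff.1 hz g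
  have ha3 : a ^ 3 = 1 := by rw [← ha]; exact pow_orderOf_eq_one a
  have ha3' : a * a * a = 1 := by rw [← ha3, pow_succ, pow_two]
  have hb2 : b * b = 1 := by rw [← pow_two, ← hb]; exact pow_orderOf_eq_one b
  have hyy : y * y ∈ Subgroup.center G := by rw [← QuotientGroup.eq_one_iff, QuotientGroup.mk_mul, hy, hb2]
  -- `k = [x, y]`, `c = k⁴`; `d = c̄` has order `3` and is inverted by `b`
  set k := x * y * x⁻¹ * y⁻¹ with hkdef
  have hkq : (k : G ⧸ Subgroup.center G) = a * a := by
    simp only [hkdef, QuotientGroup.mk_mul, QuotientGroup.mk_inv, hx, hy]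
    calc a * b * a⁻¹ * b⁻¹ = a * (b * a * b⁻¹)⁻¹ := by group
      _ = a * (a⁻¹)⁻¹ := by rw [hrel]
      _ = a * a := by group
  have hk3 : k * k * k ∈ Subgroup.center G := by
    rw [← QuotientGroup.eq_one_iff, QuotientGroup.mk_mul, QuotientGroup.mk_mul, hkq]
    calc a * a * (a * a) * (a * a) = a * a * a * (a * a * a) := by group
      _ = 1 := by rw [ha3', one_mul]
  have e := y_conj_comm hkdef hyy
  set c := k * k * k * k with hcdef
  have hc3 : c * c * c = 1 := c_cube e hk3
  have hc3' : c ^ 3 = 1 := by rw [pow_succ, pow_two]; exact hc3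
  have hyc : y * c * y⁻¹ = c⁻¹ := y_conj_c e
  have hcinv : c⁻¹ = c * c := inv_eq_of_mul_eq_one_right (by rw [← mul_assoc]; exact hc3)
  have hcq : (c : G ⧸ Subgroup.center G) = a * a := by
    simp only [hcdef, QuotientGroup.mk_mul, hkq]
    calc a * a * (a * a) * (a * a) * (a * a) = a * a * a * (a * a * a) * (a * a) := by group
      _ = a * a := by rw [ha3', one_mul, one_mul]
  set d : G ⧸ Subgroup.center G := (c : G ⧸ Subgroup.center G) with hddef
  have hd3 : orderOf d = 3 := by
    rw [hcq, ← pow_two]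
    have hco : (orderOf a).Coprime 2 := by rw [ha]; decide
    rw [hco.orderOf_pow, ha]
  have hd3' : d ^ 3 = 1 := by rw [← hd3]; exact pow_orderOf_eq_one d
  have hdinv : d⁻¹ = d ^ 2 := inv_eq_of_mul_eq_one_right (by rw [← pow_succ', hd3'])
  have hdrel : b * d * b⁻¹ = d⁻¹ := by
    rw [hcq]
    calc b * (a * a) * b⁻¹ = b * a * b⁻¹ * (b * a * b⁻¹) := by group
      _ = (a * a)⁻¹ := by rw [hrel]; group
  -- normal form `d^i b^j` in the quotient
  let f : Fin 3 × Fin 2 → G ⧸ Subgroup.center G := fun ij => d ^ (ij.1 : ℕ) * b ^ (ij.2 : ℕ)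
  have hb_nmem : b ∉ Subgroup.zpowers d := fun hmem => by
    have := orderOf_dvd_of_mem_zpowers hmem
    rw [hb, hd3] at this
    exact absurd this (by norm_num)
  have finj : Function.Injective f := by
    rintro ⟨i, j⟩ ⟨i', j'⟩ hf
    simp only [f] at hf
    have hmem : b ^ (j : ℕ) * (b ^ (j' : ℕ))⁻¹ ∈ Subgroup.zpowers d := by
      have : b ^ (j : ℕ) * (b ^ (j' : ℕ))⁻¹ = (d ^ (i : ℕ))⁻¹ * d ^ (i' : ℕ) := by
        calc b ^ (j : ℕ) * (b ^ (j' : ℕ))⁻¹ = (d ^ (i : ℕ))⁻¹ * (d ^ (i : ℕ) * b ^ (j : ℕ)) * (b ^ (j' : ℕ))⁻¹ := by group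
          _ = (d ^ (i : ℕ))⁻¹ * d ^ (i' : ℕ) := by rw [hf]; group
      rw [this]
      exact Subgroup.mul_mem _ (Subgroup.inv_mem _ (Subgroup.npow_mem_zpowers _ _)) (Subgroup.npow_mem_zpowers _ _)
    have hj : j = j' := by
      have h1 := j.isLt; have h2 := j'.isLt
      by_contra hne
      have hne' : (j : ℕ) ≠ (j' : ℕ) := fun e => hne (Fin.ext e)
      apply hb_nmem
      rcases (show ((j : ℕ) = 0 ∧ (j' : ℕ) = 1) ∨ ((j : ℕ) = 1 ∧ (j' : ℕ) = 0) by omega) with ⟨e1, e2⟩ | ⟨e1, e2⟩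
      · rw [e1, e2, pow_zero, pow_one, one_mul] at hmem
        exact (Subgroup.inv_mem_iff _).1 hmem
      · rw [e1, e2, pow_one, pow_zero, inv_one, mul_one] at hmem
        exact hmem
    subst hj
    have hi : d ^ (i : ℕ) = d ^ (i' : ℕ) := mul_right_cancel hf
    rw [pow_inj_mod, hd3, Nat.mod_eq_of_lt i.isLt, Nat.mod_eq_of_lt i'.isLt] at hi
    exact Prod.ext (Fin.ext hi) rfl
  have fbij : Function.Bijective f := finj.bijective_of_nat_card_le (by rw [card_quot_center h6]; simp)
  let eqv := Equiv.ofBijective f fbij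
  -- coordinates on the quotient
  let κq : G ⧸ Subgroup.center G → ZMod 3 := fun q => (((eqv.symm q).1 : ℕ) : ZMod 3)
  let εq : G ⧸ Subgroup.center G → ZMod 3 := fun q => if ((eqv.symm q).2 : ℕ) = 0 then 1 else -1
  have hnf : ∀ n m : ℕ, eqv.symm (d ^ n * b ^ m) = (⟨n % 3, Nat.mod_lt _ (by norm_num)⟩, ⟨m % 2, Nat.mod_lt _ (by norm_num)⟩) := by
    intro n m
    apply eqv.injective
    rw [Equiv.apply_symm_apply]
    show d ^ n * b ^ m = d ^ (n % 3) * b ^ (m % 2)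
    rw [← hd3, pow_mod_orderOf, ← hb, pow_mod_orderOf]
  have hκq : ∀ n m : ℕ, κq (d ^ n * b ^ m) = (n : ZMod 3) := by
    intro n m; simp only [κq, hnf]; exact ZMod.natCast_mod n 3
  have hεq : ∀ n m : ℕ, εq (d ^ n * b ^ m) = if m % 2 = 0 then 1 else -1 := by
    intro n m; simp only [εq, hnf]
  -- products of normal forms
  have hbd : ∀ n : ℕ, b * d ^ n = d ^ (2 * n) * b := by
    intro n
    have : b * d ^ n * b⁻¹ = d ^ (2 * n) := by rw [← conj_pow, hdrel, hdinv, ← pow_mul]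
    calc b * d ^ n = b * d ^ n * b⁻¹ * b := by group
      _ = d ^ (2 * n) * b := by rw [this]
  have hmulNF : ∀ i j i' j' : ℕ, j < 2 →
      d ^ i * b ^ j * (d ^ i' * b ^ j') = d ^ (i + if j = 0 then i' else 2 * i') * b ^ (j + j') := by
    intro i j i' j' hj
    interval_cases j
    · simp only [pow_zero, mul_one, if_true, zero_add, pow_add]; group
    · simp only [pow_one, one_ne_zero, if_false, pow_add]
      calc d ^ i * b * (d ^ i' * b ^ j') = d ^ i * (b * d ^ i') * b ^ j' := by group
        _ = d ^ i * (d ^ (2 * i') * b) * b ^ j' := by rw [hbd]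
        _ = d ^ i * d ^ (2 * i') * (b * b ^ j') := by group
  have hcoc : ∀ p q : G ⧸ Subgroup.center G, κq (p * q) = κq p + εq p * κq q := by
    intro p q
    obtain ⟨⟨i, j⟩, rfl⟩ := eqv.surjective p
    obtain ⟨⟨i', j'⟩, rfl⟩ := eqv.surjective q
    show κq (d ^ (i : ℕ) * b ^ (j : ℕ) * (d ^ (i' : ℕ) * b ^ (j' : ℕ))) =
      κq (d ^ (i : ℕ) * b ^ (j : ℕ)) + εq (d ^ (i : ℕ) * b ^ (j : ℕ)) * κq (d ^ (i' : ℕ) * b ^ (j' : ℕ))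
    rw [hmulNF _ _ _ _ j.isLt, hκq, hκq, hκq, hεq, Nat.mod_eq_of_lt j.isLt]
    split_ifs with hj0
    · push_cast; ring
    · have h2 : (2 : ZMod 3) = -1 := by decide
      push_cast; rw [h2]
  have hεmul : ∀ p q : G ⧸ Subgroup.center G, εq (p * q) = εq p * εq q := by
    intro p q
    obtain ⟨⟨i, j⟩, rfl⟩ := eqv.surjective p
    obtain ⟨⟨i', j'⟩, rfl⟩ := eqv.surjective q
    show εq (d ^ (i : ℕ) * b ^ (j : ℕ) * (d ^ (i' : ℕ) * b ^ (j' : ℕ))) =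
      εq (d ^ (i : ℕ) * b ^ (j : ℕ)) * εq (d ^ (i' : ℕ) * b ^ (j' : ℕ))
    rw [hmulNF _ _ _ _ j.isLt, hεq, hεq, hεq]
    have h1 := j.isLt; have h2 := j'.isLt
    rcases (show (j : ℕ) = 0 ∨ (j : ℕ) = 1 by omega) with hj | hj <;>
      rcases (show (j' : ℕ) = 0 ∨ (j' : ℕ) = 1 by omega) with hj' | hj' <;> simp [hj, hj']
  have hsign : ∀ q : G ⧸ Subgroup.center G, εq q = 1 ∨ εq q = -1 := fun q => by simp only [εq]; split_ifs <;> simp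
  -- the complement `C = Z(G) ∪ y Z(G)`
  let InC : G → Prop := fun g => g ∈ Subgroup.center G ∨ y⁻¹ * g ∈ Subgroup.center G
  have hCconj1 : ∀ g, InC g → g * c * g⁻¹ = c ∨ g * c * g⁻¹ = c * c := by
    rintro g (hg | hg)
    · left; rw [← hZ hg c]; group
    · right
      calc g * c * g⁻¹ = y * ((y⁻¹ * g) * c) * (y⁻¹ * g)⁻¹ * y⁻¹ := by group
        _ = y * (c * (y⁻¹ * g)) * (y⁻¹ * g)⁻¹ * y⁻¹ := by rw [← hZ hg c]
        _ = y * c * y⁻¹ := by group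
        _ = c * c := by rw [hyc, hcinv]
  have hCconj : ∀ g, InC g → ∀ n : ℕ, ∃ m : ℕ, g * c ^ n * g⁻¹ = c ^ m := by
    intro g hg n
    rcases hCconj1 g hg with h1 | h1
    · exact ⟨n, by rw [← conj_pow, h1]⟩
    · exact ⟨2 * n, by rw [← conj_pow, h1, ← pow_two, ← pow_mul]⟩
  have hCcomm : ∀ g h, InC g → InC h → g * h = h * g := by
    rintro g h (hg | hg) hh
    · exact (hZ hg h).symm
    · rcases hh with hh | hh
      · exact hZ hh g
      · have e1 : g * h = y * (y * (y⁻¹ * g)) * (y⁻¹ * h) := by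
          calc g * h = y * ((y⁻¹ * g) * y) * (y⁻¹ * h) := by group
            _ = y * (y * (y⁻¹ * g)) * (y⁻¹ * h) := by rw [← hZ hg y]
        have e2 : h * g = y * (y * (y⁻¹ * h)) * (y⁻¹ * g) := by
          calc h * g = y * ((y⁻¹ * h) * y) * (y⁻¹ * g) := by group
            _ = y * (y * (y⁻¹ * h)) * (y⁻¹ * g) := by rw [← hZ hh y]
        calc g * h = y * (y * (y⁻¹ * g)) * (y⁻¹ * h) := e1
          _ = y * y * ((y⁻¹ * g) * (y⁻¹ * h)) := by group
          _ = y * y * ((y⁻¹ * h) * (y⁻¹ * g)) := by rw [← hZ hg (y⁻¹ * h)]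
          _ = h * g := by rw [e2]; group
  have hCmul : ∀ g h, InC g → InC h → InC (g * h) := by
    rintro g h (hg | hg) (hh | hh)
    · exact Or.inl (Subgroup.mul_mem _ hg hh)
    · right
      have : y⁻¹ * (g * h) = g * (y⁻¹ * h) := by rw [← mul_assoc, hZ hg y⁻¹, mul_assoc]
      rw [this]; exact Subgroup.mul_mem _ hg hh
    · right; rw [← mul_assoc]; exact Subgroup.mul_mem _ hg hh
    · left
      have : g * h = y * y * ((y⁻¹ * g) * (y⁻¹ * h)) := by
        calc g * h = y * ((y⁻¹ * g) * y) * (y⁻¹ * h) := by group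
          _ = y * (y * (y⁻¹ * g)) * (y⁻¹ * h) := by rw [← hZ hg y]
          _ = y * y * ((y⁻¹ * g) * (y⁻¹ * h)) := by group
      rw [this]; exact Subgroup.mul_mem _ hyy (Subgroup.mul_mem _ hg hh)
  have hCinv : ∀ g, InC g → InC g⁻¹ := by
    rintro g (hg | hg)
    · exact Or.inl (Subgroup.inv_mem _ hg)
    · right
      have : y⁻¹ * g⁻¹ = (y⁻¹ * g)⁻¹ * (y * y)⁻¹ := by
        calc y⁻¹ * g⁻¹ = y⁻¹ * (y⁻¹ * g)⁻¹ * y⁻¹ := by group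
          _ = (y⁻¹ * g)⁻¹ * y⁻¹ * y⁻¹ := by rw [hZ (Subgroup.inv_mem _ hg) y⁻¹]
          _ = (y⁻¹ * g)⁻¹ * (y * y)⁻¹ := by group
      rw [this]; exact Subgroup.mul_mem _ (Subgroup.inv_mem _ hg) (Subgroup.inv_mem _ hyy)
  -- decomposition `g = c^n γ`, `γ ∈ C`
  have hdec : ∀ g : G, ∃ (n : ℕ) (γ : G), InC γ ∧ g = c ^ n * γ := by
    intro g
    obtain ⟨⟨i, j⟩, hij⟩ := eqv.surjective (g : G ⧸ Subgroup.center G)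
    have hij' : d ^ (i : ℕ) * b ^ (j : ℕ) = (g : G ⧸ Subgroup.center G) := hij
    refine ⟨i, (c ^ (i : ℕ))⁻¹ * g, ?_, by group⟩
    have hγ : (((c ^ (i : ℕ))⁻¹ * g : G) : G ⧸ Subgroup.center G) = b ^ (j : ℕ) := by
      rw [QuotientGroup.mk_mul, QuotientGroup.mk_inv, QuotientGroup.mk_pow, ← hij', ← hddef]; group
    have hj := j.isLt
    rcases (show (j : ℕ) = 0 ∨ (j : ℕ) = 1 by omega) with hj0 | hj1
    · left; rw [← QuotientGroup.eq_one_iff, hγ, hj0, pow_zero]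
    · right; rw [← QuotientGroup.eq, hy, hγ, hj1, pow_one]
  -- powers of `c`
  have hcpow : ∀ n : ℕ, c ^ n = c ^ (n % 3) := fun n => by
    calc c ^ n = c ^ (3 * (n / 3) + n % 3) := by rw [Nat.div_add_mod]
      _ = c ^ (n % 3) := by rw [pow_add, pow_mul, hc3', one_pow, one_mul]
  have hKpow : ∀ n : ℕ, c ^ n = 1 ∨ c ^ n = c ∨ c ^ n = c * c := fun n => by
    rw [hcpow n]
    have := Nat.mod_lt n (show 3 > 0 by norm_num)
    interval_cases (n % 3)
    · exact Or.inl (pow_zero c)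
    · exact Or.inr (Or.inl (pow_one c))
    · exact Or.inr (Or.inr (pow_two c))
  have hcinv_pow : ∀ q : ℕ, (c ^ q)⁻¹ = c ^ (2 * q) := fun q =>
    inv_eq_of_mul_eq_one_right (by rw [← pow_add, show q + 2 * q = 3 * q by ring, pow_mul, hc3', one_pow])
  -- the commutator axiom
  have hcommK : ∀ a' b' : G, ∃ u, (u = 1 ∨ u = c ∨ u = c * c) ∧ a' * b' = b' * a' * u := by
    intro a' b'
    obtain ⟨i, γ, hγ, rfl⟩ := hdec a'
    obtain ⟨i', δ, hδ, rfl⟩ := hdec b'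
    obtain ⟨m1, hm1⟩ := hCconj γ hγ i'
    obtain ⟨m2, hm2⟩ := hCconj δ hδ i
    have hγδ : γ * δ = δ * γ := hCcomm γ δ hγ hδ
    have e1 : c ^ i * γ * (c ^ i' * δ) = c ^ (i + m1) * (γ * δ) := by
      calc c ^ i * γ * (c ^ i' * δ) = c ^ i * (γ * c ^ i' * γ⁻¹) * (γ * δ) := by group
        _ = c ^ (i + m1) * (γ * δ) := by rw [hm1, pow_add]
    have e2 : c ^ i' * δ * (c ^ i * γ) = c ^ (i' + m2) * (γ * δ) := by
      calc c ^ i' * δ * (c ^ i * γ) = c ^ i' * (δ * c ^ i * δ⁻¹) * (δ * γ) := by group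
        _ = c ^ (i' + m2) * (γ * δ) := by rw [hm2, pow_add, hγδ]
    obtain ⟨m3, hm3⟩ := hCconj (γ * δ)⁻¹ (hCinv _ (hCmul _ _ hγ hδ)) (2 * (i' + m2) + (i + m1))
    rw [inv_inv] at hm3
    refine ⟨c ^ m3, hKpow m3, ?_⟩
    rw [e1, e2, ← hm3]
    calc c ^ (i + m1) * (γ * δ) = c ^ (i' + m2) * ((c ^ (i' + m2))⁻¹ * c ^ (i + m1)) * (γ * δ) := by group
      _ = c ^ (i' + m2) * (c ^ (2 * (i' + m2)) * c ^ (i + m1)) * (γ * δ) := by rw [hcinv_pow]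
      _ = c ^ (i' + m2) * (γ * δ) * ((γ * δ)⁻¹ * c ^ (2 * (i' + m2) + (i + m1)) * (γ * δ)) := by rw [pow_add]; group
  -- assemble
  refine ⟨c, fun g => κq g, fun g => εq g, hc3, ?_, fun g => hsign g, fun g g' => ?_, fun g g' => ?_, hcommK⟩
  · show κq d = 1
    have : d = d ^ 1 * b ^ 0 := by rw [pow_one, pow_zero, mul_one]
    rw [this, hκq]; simp
  · show κq ((g * g' : G) : G ⧸ Subgroup.center G) = _
    rw [QuotientGroup.mk_mul]; exact hcoc _ _
  · show εq ((g * g' : G) : G ⧸ Subgroup.center G) = _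
    rw [QuotientGroup.mk_mul]; exact hεmul _ _

end IndexSix

/-! ## The literal law -/

/-- **`[G : Z(G)] = 6 ⇒ 3·|S||T||U| ≤ 5·|G|`** for every TPP triple with `|T|, |U| ≤ 3` (`5|G|/3 = Σ_χ χ(1)³`). [folklore] -/
theorem three_mul_volume_le_of_index_center [Fintype G] [DecidableEq G] (h6 : (Subgroup.center G).index = 6) {S T U : Finset G}
    (htpp : TripleProductProperty S T U) (hT : #T ≤ 3) (hU : #U ≤ 3) : 3 * (#S * #T * #U) ≤ 5 * Fintype.card G := by
  obtain ⟨c, κ, ε, h⟩ := exists_coord h6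
  exact h.three_mul_volume_le htpp hT hU

/-- **`[G : Z(G)] = 6` and `5|G| < 27N` ⇒ no `⟨N, 3, 3⟩` in `G`**, in any order of the sizes (Neumann's bound for all groups is
`5N ≤ |G|`; here `27N ≤ 5|G|` is necessary). [folklore] -/
theorem not_realizesTPP_three_three_of_index_center [Fintype G] [DecidableEq G] (h6 : (Subgroup.center G).index = 6) (N : ℕ)
    (hlt : 5 * Fintype.card G < 27 * N) :
    ¬ Literature.Computability.AlgebraicComplexity.RealizesTPP G N 3 3 ∧
      ¬ Literature.Computability.AlgebraicComplexity.RealizesTPP G 3 N 3 ∧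
        ¬ Literature.Computability.AlgebraicComplexity.RealizesTPP G 3 3 N := by
  obtain ⟨c, κ, ε, h⟩ := exists_coord h6
  exact h.not_realizesTPP_three_three N hlt

end Summit.MatrixMultiplication.OmegaCensus.CentreIndexSix
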